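import Literature.MathematicalPhysics.QuantumFieldTheory.Balaban1983to89.B6Eq218Lagrangian

/-!
# `Balaban1983to89.B6GOmegaCritical` — T. Bałaban, *Propagators and renormalization transformations for lattice gauge
# theories. II*, Commun. Math. Phys. **96** (1984) 223–250 [Balaban1984PropagatorsII], Sect. A p. 228: the variational
# problem (2.5), (2.6), (2.12) *"solved in a different way"* with Dirichlet boundary conditions on `Ω^c` — the split of the
# quadratic form, the `Ω`-Lagrange function, its critical point `A = G(Ω)Q*(QG(Ω)Q*)⁻¹B + G(Ω)Q*(QG(Ω)Q*)⁻¹QG(Ω)∂*∂Ω^cB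
# − G(Ω)∂*∂Ω^cB`, *"the equalities (2.31), (2.34) hold for the operator G(Ω) also"*, and *"(2.35) with G(Ω) instead of G"*
# — PROVED over abstract real inner-product carriers

statement-level skeleton of published theorems with citation tags; proofs where landed; nothing here is a claim about the Yang–Mills mass gap

PDF held: `paper:balaban1984-cmp96-propagators-rt-ii` (journal page = PDF page + 222); p. 228 [PDF 6] read AS AN IMAGE on the
×2 render `run/shared/lean/pub/pub-balaban/b2b-balaban-ref1/pages/1984-cmp96-propagators-rt-II/…-p006-x2.png`.

CITATION HEADER (lean-in-tree rule).  WHAT IS REPRODUCED: lit-balaban SKELETON row **B6.Txt@228** (the unnumbered p. 228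
displays of the `G(Ω)` variant; until now `typed-existing` — the tree's `…B6GOmega` types the COMPRESSION `(ΩΔ_aΩ)` and its
inherited bounds, not the variational derivation).  Unit `lit-balaban-r03` (B6 reader/typer and fold owner, gen 3), PHASE 2,
HOME `run/shared/lean/pub/lit-balaban/`, 2026-08-21.  IMPORTS `…B6Eq218Lagrangian` (this seat, p246073: the carriers and
`inner_deltaA`, the quadratic form of (2.19)) and through it `…B6SectA` (`gaugeSpace` = N(Q′), `hOp` (2.35)); nothing
restated.  The whole-lattice identities (2.31)/(2.34) are `…B6Eq231` (p239491); the present file proves their `G(Ω)`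
versions from the SAME structural facts, localized to `N(Q′)`.

PRINT (p. 228, verbatim).  *"The variational problem (2.5), (2.6), (2.12) can be solved also in a different way. We use the
fact that the configuration A is fixed outside Ω₁ by the conditions (2.6), thus we should obtain a solution of the problem
using operators chosen arbitrarily there, especially operators with arbitrary boundary conditions outside Ω₁. Let us take a
neighbourhood Ω of the domain Ω₁. We assume that it is a sum of big blocks of the lattice T₁. … We will consider operators
with Dirichlet boundary conditions on Ω^c. For the quadratic form (2.5) we have by (2.6),
½⟨A, ∂*∂A⟩ = ½⟨A, Ω∂*∂ΩA⟩ + ⟨A, Ω∂*∂Ω^cB⟩ + ½⟨B, Ω^c∂*∂Ω^cB⟩,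
hence the Lagrange function can be taken as equal to
h(A, λ, ω) = ½⟨A, ΩΔ_aΩA⟩ + ⟨A, Ω∂*∂Ω^cB⟩ + ½⟨B, Ω^c∂*∂Ω^cB⟩ − ½⟨ΩB, aΩB⟩ − ⟨λ, R∂*A⟩ − ⟨ω, QA − B⟩,
Rλ = λ, ω = 0 on Ω^c. We may take also R defined by operators with Dirichlet boundary conditions on Ω^c. Solving critical
point equations for h(A, λ, ω) and denoting G(Ω) = (Δ_a↾_Ω)⁻¹ = (ΩΔ_aΩ)⁻¹, we get
A = G(Ω)Q*(QG(Ω)Q*)⁻¹B + G(Ω)Q*(QG(Ω)Q*)⁻¹QG(Ω)∂*∂Ω^cB − G(Ω)∂*∂Ω^cB.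
We have to notice only that the equalities (2.31), (2.34) hold for the operator G(Ω) also. If B = 0 outside Ω₁, then the
above representation simplifies and we get (2.35) with G(Ω) instead of G. All the reasonings and the results of this paper
hold, with minor and obvious changes, for the operators G(Ω)."*

DICTIONARY / READINGS (every choice displayed as a binder; none is an objection to print).  Carriers as in
`…B6Eq218Lagrangian`: `P` plaquette fields, `A` bond fields, `V` site scalars, `W` constraint values; `∂` on vector fields
= `dc : A → P` with adjoint `dcs` (so `∂*∂ = dcs∘dc`), `∂` on scalars = `d : V → A` with adjoint `∂* = dstar`; `R = Rp`,
`Q`/`Q* = Qs`, `a`; `Δ_a = ∂*∂ + ∂R∂* + Q*aQ` (2.19) (`hΔa`).  `Ω : A → A` = restriction to the bonds of Ω (symmetric: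
`hΩ`); the configuration is `A = x + X` with `x = ΩA` the variable part and `X = Ω^cB` the fixed exterior part (`ΩX = 0`,
`hX`); *"ω = 0 on Ω^c"* and `ΩB` are modelled by taking `Q`, `B` to be the constraints INSIDE `Ω` (one constraint map, as in
(2.20)).  `G = G(Ω)`: `GΩ = G` (`hGΩ`), `ΩG = G` (`hΩG`), left/right inverse of `ΩΔ_aΩ` on `ΩA` (`hG`/`hG'`), symmetric
(`hGs`, as the inverse of the symmetric `Δ_a↾_Ω`); `E = (QG(Ω)Q*)⁻¹` (`hE`/`hE'`).  STRUCTURE (the facts behind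
(2.28)–(2.34), localized): `N(Q′) = B6SectA.gaugeSpace Q′`; `∂∂ = 0` i.e. `dc∘d = 0` (`hcurl`); `Q∂n = 0` for `n ∈ N(Q′)`
(`hQd`, (2.7)/(2.34)); `R` maps into `ΔN(Q′) = ∂*∂N(Q′)` and fixes it (`hRrange`, `hRfix`, p. 225); SUPPORT (Ω ⊃ Ω₁ with a
margin, *"a sum of big blocks … with distances to Ω₁ ≦ RM"*): `Ω∂n = ∂n` for `n ∈ N(Q′)` (`hΩd`), `Ω∂Rμ = ∂Rμ` (`hΩdR`).

WHAT IS PROVED (0 sorry, 0 new named facts).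
§1 `form_split` — the first display (*"For the quadratic form (2.5) we have by (2.6) …"*).
§2 `lagrangeHO` — the `Ω`-Lagrange function WITH BODY; `lagrangeHO_add_x/_lam/_omega` — its exact expansions;
   `ELO` — its critical-point system for variations of `x` inside `Ω` (`Ωx = x`, `Ω[ΩΔ_aΩx + Ω∂*∂X − ∂Rλ − Q*ω] = 0`,
   `R∂*x = 0`, `Qx = B`); `stationary_iff_ELO` — the linear parts vanish along all admissible variations iff `ELO`.
§3 `G_d_R` — `G(Ω)∂Rμ = ∂n` (`Rμ = Δn`, `n ∈ N(Q′)`); hence ***"(2.31), (2.34) hold for the operator G(Ω) also"***: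
   `eq231_Omega : R∂*G(Ω)∂R = R`, `eq234_Omega_right : QG(Ω)∂R = 0`, `eq234_Omega_left : R∂*G(Ω)Q* = 0`; and
   `R_dstar_G_C : R∂*G(Ω)Ω∂*∂X = 0` (the same mechanism on the exterior source).
§4 THE CRITICAL POINT: `lam_eq_zero` — at any solution of `ELO` the multiplier `λ` VANISHES (gauge invariance: pair the
   first equation with `∂n`, `n ∈ N(Q′)`); **`critical_repr`** — the printed representation
   `x = G(Ω)Q*(QG(Ω)Q*)⁻¹B + G(Ω)Q*(QG(Ω)Q*)⁻¹QG(Ω)∂*∂X − G(Ω)∂*∂X` (and `ω = (QG(Ω)Q*)⁻¹(B + QG(Ω)∂*∂X)`);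
   **`critical_repr_of_exterior_zero`** — *"If B = 0 outside Ω₁ … we get (2.35) with G(Ω) instead of G"*: `x = hOp G(Ω) Q* E B`;
   `ELO_repr` — conversely the printed triple solves `ELO`; `existsUnique_ELO`.
NOT HERE: the bounds / *"All the reasonings and the results of this paper hold … for G(Ω)"* (tree: `…B6GOmega`, the
compression inherits [3] (5.6)); the gradient packaging of §2 (done for (2.18) in `…B6Eq218Lagrangian`; here the exact
expansions carry the same content).
-/

noncomputable section

open scoped InnerProductSpace

namespace Literature.MathematicalPhysics.QuantumFieldTheory.Balaban1983to89.B6GOmegaCritical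

variable {P A V W W' : Type*}
  [NormedAddCommGroup P] [InnerProductSpace ℝ P]
  [NormedAddCommGroup A] [InnerProductSpace ℝ A]
  [NormedAddCommGroup V] [InnerProductSpace ℝ V]
  [NormedAddCommGroup W] [InnerProductSpace ℝ W]
  [AddCommGroup W'] [Module ℝ W']

/-! ## §1 The split of the quadratic form (2.5) along `A = ΩA + Ω^cB` -/

/-- **p. 228, first display**: *"For the quadratic form (2.5) we have by (2.6),
½⟨A, ∂*∂A⟩ = ½⟨A, Ω∂*∂ΩA⟩ + ⟨A, Ω∂*∂Ω^cB⟩ + ½⟨B, Ω^c∂*∂Ω^cB⟩"* — for `A = x + X`, `x = ΩA` (`Ωx = x`), `X = Ω^cB`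
(`ΩX = 0`), `∂*∂ = dcs∘dc`, `Ω` symmetric. [cite: Balaban1984PropagatorsII, p.228 (first display)] -/
theorem form_split (dc : A →ₗ[ℝ] P) (dcs : P →ₗ[ℝ] A) (Ω : A →ₗ[ℝ] A)
    (hdc : ∀ (p : P) (y : A), ⟪dcs p, y⟫_ℝ = ⟪p, dc y⟫_ℝ) (hΩ : ∀ y z : A, ⟪Ω y, z⟫_ℝ = ⟪y, Ω z⟫_ℝ)
    {x X : A} (hx : Ω x = x) (hX : Ω X = 0) :
    (1 / 2) * ⟪x + X, dcs (dc (x + X))⟫_ℝ =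
      (1 / 2) * ⟪x + X, Ω (dcs (dc (Ω (x + X))))⟫_ℝ + ⟪x + X, Ω (dcs (dc X))⟫_ℝ
        + (1 / 2) * ⟪X, dcs (dc X)⟫_ℝ := by
  have hΩsum : Ω (x + X) = x := by rw [map_add, hx, hX, add_zero]
  have e1 : ⟪x + X, Ω (dcs (dc (Ω (x + X))))⟫_ℝ = ⟪dc x, dc x⟫_ℝ := by
    rw [hΩsum, ← hΩ, hΩsum, real_inner_comm, hdc, real_inner_comm]
  have e2 : ⟪x + X, Ω (dcs (dc X))⟫_ℝ = ⟪dc x, dc X⟫_ℝ := by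
    rw [← hΩ, hΩsum, real_inner_comm, hdc, real_inner_comm]
  have e3 : ⟪X, dcs (dc X)⟫_ℝ = ⟪dc X, dc X⟫_ℝ := by rw [real_inner_comm, hdc, real_inner_comm]
  have e0 : ⟪x + X, dcs (dc (x + X))⟫_ℝ = ⟪dc (x + X), dc (x + X)⟫_ℝ := by
    rw [real_inner_comm, hdc, real_inner_comm]
  rw [e0, e1, e2, e3, map_add, inner_add_left, inner_add_right, inner_add_right, real_inner_comm (dc x) (dc X)]
  ring

/-! ## §2 The `Ω`-Lagrange function of p. 228 and its critical-point system -/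

/-- **p. 228, the Lagrange function with Dirichlet boundary conditions on `Ω^c`**:
`h(A, λ, ω) = ½⟨A, ΩΔ_aΩA⟩ + ⟨A, Ω∂*∂Ω^cB⟩ + ½⟨B, Ω^c∂*∂Ω^cB⟩ − ½⟨ΩB, aΩB⟩ − ⟨λ, R∂*A⟩ − ⟨ω, QA − B⟩` (`Rλ = λ`,
`ω = 0` on `Ω^c`) — variable `x = ΩA`, exterior field `X = Ω^cB`, constraint datum `B` (inside `Ω`).
[cite: Balaban1984PropagatorsII, p.228 (Lagrange function display)] -/
def lagrangeHO (ΔA : A →ₗ[ℝ] A) (dc : A →ₗ[ℝ] P) (dcs : P →ₗ[ℝ] A) (a : W →ₗ[ℝ] W) (dstar : A →ₗ[ℝ] V)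
    (Rp : V →ₗ[ℝ] V) (Q : A →ₗ[ℝ] W) (Ω : A →ₗ[ℝ] A) (X : A) (B : W) (x : A) (lam : V) (ω : W) : ℝ :=
  (1 / 2) * ⟪x, Ω (ΔA (Ω x))⟫_ℝ + ⟪x, Ω (dcs (dc X))⟫_ℝ + (1 / 2) * ⟪X, dcs (dc X)⟫_ℝ
    - (1 / 2) * ⟪B, a B⟫_ℝ - ⟪lam, Rp (dstar x)⟫_ℝ - ⟪ω, Q x - B⟫_ℝ

section Structure

variable (ΔA : A →ₗ[ℝ] A) (dc : A →ₗ[ℝ] P) (dcs : P →ₗ[ℝ] A) (a : W →ₗ[ℝ] W) (d : V →ₗ[ℝ] A)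
  (dstar : A →ₗ[ℝ] V) (Rp : V →ₗ[ℝ] V) (Q : A →ₗ[ℝ] W) (Qs : W →ₗ[ℝ] A) (Ω : A →ₗ[ℝ] A) (X : A) (B : W)

/-- **δh/δA on p. 228**: the exact expansion of the `Ω`-Lagrange function in the configuration — linear part
`⟨x′, ΩΔ_aΩx + Ω∂*∂X − ∂Rλ − Q*ω⟩`, quadratic part `½⟨x′, ΩΔ_aΩx′⟩` (`Δ_a`, `R`, `Ω` symmetric; `∂`, `Q*` adjoints).
[cite: Balaban1984PropagatorsII, p.228 (critical point equations for h(A, λ, ω))] -/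
theorem lagrangeHO_add_x (hΔ : ∀ y z : A, ⟪ΔA y, z⟫_ℝ = ⟪y, ΔA z⟫_ℝ)
    (hd : ∀ (v : V) (y : A), ⟪d v, y⟫_ℝ = ⟪v, dstar y⟫_ℝ) (hR : ∀ u v : V, ⟪Rp u, v⟫_ℝ = ⟪u, Rp v⟫_ℝ)
    (hQ : ∀ (w : W) (y : A), ⟪Qs w, y⟫_ℝ = ⟪w, Q y⟫_ℝ) (hΩ : ∀ y z : A, ⟪Ω y, z⟫_ℝ = ⟪y, Ω z⟫_ℝ)
    (x x' : A) (lam : V) (ω : W) :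
    lagrangeHO ΔA dc dcs a dstar Rp Q Ω X B (x + x') lam ω =
      lagrangeHO ΔA dc dcs a dstar Rp Q Ω X B x lam ω
        + ⟪x', Ω (ΔA (Ω x)) + Ω (dcs (dc X)) - d (Rp lam) - Qs ω⟫_ℝ + (1 / 2) * ⟪x', Ω (ΔA (Ω x'))⟫_ℝ := by
  have h1 : ⟪x, Ω (ΔA (Ω x'))⟫_ℝ = ⟪x', Ω (ΔA (Ω x))⟫_ℝ := by
    rw [← hΩ, ← hΔ, ← hΩ, real_inner_comm]
  have h2 : ⟪lam, Rp (dstar x')⟫_ℝ = ⟪x', d (Rp lam)⟫_ℝ := by rw [← hR, ← hd, real_inner_comm]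
  have h3 : ⟪ω, Q x'⟫_ℝ = ⟪x', Qs ω⟫_ℝ := by rw [← hQ, real_inner_comm]
  simp only [lagrangeHO, map_add, inner_add_left, inner_add_right, inner_sub_right, add_sub_assoc]
  rw [h1, h2, h3]
  ring

/-- **δh/δλ on p. 228**: `h(x, λ + λ′, ω) = h(x, λ, ω) − ⟨λ′, R∂*x⟩`. [cite: Balaban1984PropagatorsII, p.228 (critical point equations for h(A, λ, ω))] -/
theorem lagrangeHO_add_lam (x : A) (lam lam' : V) (ω : W) :
    lagrangeHO ΔA dc dcs a dstar Rp Q Ω X B x (lam + lam') ω =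
      lagrangeHO ΔA dc dcs a dstar Rp Q Ω X B x lam ω - ⟪lam', Rp (dstar x)⟫_ℝ := by
  simp only [lagrangeHO, inner_add_left]
  ring

/-- **δh/δω on p. 228**: `h(x, λ, ω + ω′) = h(x, λ, ω) − ⟨ω′, Qx − B⟩`. [cite: Balaban1984PropagatorsII, p.228 (critical point equations for h(A, λ, ω))] -/
theorem lagrangeHO_add_omega (x : A) (lam : V) (ω ω' : W) :
    lagrangeHO ΔA dc dcs a dstar Rp Q Ω X B x lam (ω + ω') =
      lagrangeHO ΔA dc dcs a dstar Rp Q Ω X B x lam ω - ⟪ω', Q x - B⟫_ℝ := by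
  simp only [lagrangeHO, inner_add_left]
  ring

/-- **The critical-point system of the `Ω`-Lagrange function** (*"Solving critical point equations for h(A, λ, ω)"*):
the variable lives on the bonds of `Ω` (`Ωx = x`) and is varied there, so the first equation is the `Ω`-projection of the
linear part of `lagrangeHO_add_x`; the other two are `R∂*x = 0`, `Qx = B` (the multiplier side condition `Rλ = λ` is
carried separately, as in print). [cite: Balaban1984PropagatorsII, p.228 (critical point equations for h(A, λ, ω))] -/
def ELO (x : A) (lam : V) (ω : W) : Prop :=
  Ω x = x ∧ Ω (Ω (ΔA (Ω x)) + Ω (dcs (dc X)) - d (Rp lam) - Qs ω) = 0 ∧ Rp (dstar x) = 0 ∧ Q x = B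

/-- **Stationarity ⟺ `ELO`**: for a configuration on the bonds of `Ω`, the linear parts of the three expansions vanish
along every admissible variation (`x′ = Ωx′` inside `Ω`; all `λ′`, `ω′`) iff the critical-point system holds.
[cite: Balaban1984PropagatorsII, p.228 (critical point equations for h(A, λ, ω))] -/
theorem stationary_iff_ELO (hΩ : ∀ y z : A, ⟪Ω y, z⟫_ℝ = ⟪y, Ω z⟫_ℝ) {x : A} (hx : Ω x = x) (lam : V) (ω : W) :
    ((∀ x' : A, ⟪Ω x', Ω (ΔA (Ω x)) + Ω (dcs (dc X)) - d (Rp lam) - Qs ω⟫_ℝ = 0) ∧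
        (∀ lam' : V, ⟪lam', Rp (dstar x)⟫_ℝ = 0) ∧ (∀ ω' : W, ⟪ω', Q x - B⟫_ℝ = 0)) ↔
      ELO ΔA dc dcs d dstar Rp Q Qs Ω X B x lam ω := by
  constructor
  · rintro ⟨h1, h2, h3⟩
    refine ⟨hx, ?_, ?_, ?_⟩
    · have h1' : ⟪Ω (Ω (ΔA (Ω x)) + Ω (dcs (dc X)) - d (Rp lam) - Qs ω),
          Ω (Ω (ΔA (Ω x)) + Ω (dcs (dc X)) - d (Rp lam) - Qs ω)⟫_ℝ = 0 := by
        rw [← hΩ]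
        exact h1 _
      exact inner_self_eq_zero.mp h1'
    · exact inner_self_eq_zero.mp (h2 _)
    · have := h3 (Q x - B)
      rwa [inner_self_eq_zero, sub_eq_zero] at this
  · rintro ⟨_, h1, h2, h3⟩
    refine ⟨fun x' => ?_, fun lam' => ?_, fun ω' => ?_⟩
    · rw [hΩ, h1, inner_zero_right]
    · rw [h2, inner_zero_right]
    · rw [h3, sub_self, inner_zero_right]

end Structure

/-! ## §3 "the equalities (2.31), (2.34) hold for the operator G(Ω) also" -/

section Identities

variable (ΔA : A →ₗ[ℝ] A) (dc : A →ₗ[ℝ] P) (dcs : P →ₗ[ℝ] A) (a : W →ₗ[ℝ] W) (d : V →ₗ[ℝ] A)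
  (dstar : A →ₗ[ℝ] V) (Rp : V →ₗ[ℝ] V) (Qp : V →ₗ[ℝ] W') (Q : A →ₗ[ℝ] W) (Qs : W →ₗ[ℝ] A) (Ω G : A →ₗ[ℝ] A)

/-- **The mechanism** (localized form of `B6Eq231.apply_G_d_R`): if `Rμ = ∂*∂n` with `n ∈ N(Q′)`, then
`ΩΔ_aΩ(∂n) = ∂Rμ` (the curl–curl and averaging terms of (2.19) vanish on the pure gauge `∂n`, which lives inside `Ω`),
hence `G(Ω)∂Rμ = ∂n`. [cite: Balaban1984PropagatorsII, p.228 ((2.31), (2.34) for G(Ω))] -/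
theorem G_d_R (hΔa : ΔA = dcs ∘ₗ dc + d ∘ₗ Rp ∘ₗ dstar + Qs ∘ₗ a ∘ₗ Q) (hcurl : dc ∘ₗ d = 0)
    (hQd : ∀ n ∈ B6SectA.gaugeSpace Qp, Q (d n) = 0)
    (hRfix : ∀ n ∈ B6SectA.gaugeSpace Qp, Rp (dstar (d n)) = dstar (d n))
    (hΩd : ∀ n ∈ B6SectA.gaugeSpace Qp, Ω (d n) = d n) (hΩdR : ∀ v : V, Ω (d (Rp v)) = d (Rp v))
    (hG : ∀ y : A, G (Ω (ΔA (Ω y))) = Ω y)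
    {μ n : V} (hn : n ∈ B6SectA.gaugeSpace Qp) (hμ : Rp μ = dstar (d n)) :
    G (d (Rp μ)) = d n := by
  have hcurl' : dc (d n) = 0 := by simpa using LinearMap.congr_fun hcurl n
  have key : Ω (ΔA (Ω (d n))) = d (Rp μ) := by
    rw [hΩd n hn, hΔa]
    simp only [LinearMap.add_apply, LinearMap.coe_comp, Function.comp_apply, hcurl', map_zero, zero_add,
      hQd n hn, add_zero, hRfix n hn]
    rw [← hμ, hΩdR]
  have := hG (d n)
  rw [key, hΩd n hn] at this
  exact this

/-- **(2.31) for `G(Ω)`: `R∂*G(Ω)∂R = R`.** [cite: Balaban1984PropagatorsII, p.228 ((2.31), (2.34) for G(Ω))] -/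
theorem eq231_Omega (hΔa : ΔA = dcs ∘ₗ dc + d ∘ₗ Rp ∘ₗ dstar + Qs ∘ₗ a ∘ₗ Q) (hcurl : dc ∘ₗ d = 0)
    (hQd : ∀ n ∈ B6SectA.gaugeSpace Qp, Q (d n) = 0)
    (hRrange : ∀ v : V, ∃ n ∈ B6SectA.gaugeSpace Qp, Rp v = dstar (d n))
    (hRfix : ∀ n ∈ B6SectA.gaugeSpace Qp, Rp (dstar (d n)) = dstar (d n))
    (hΩd : ∀ n ∈ B6SectA.gaugeSpace Qp, Ω (d n) = d n) (hΩdR : ∀ v : V, Ω (d (Rp v)) = d (Rp v))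
    (hG : ∀ y : A, G (Ω (ΔA (Ω y))) = Ω y) :
    Rp ∘ₗ dstar ∘ₗ G ∘ₗ d ∘ₗ Rp = Rp := by
  ext μ
  obtain ⟨n, hn, hμ⟩ := hRrange μ
  simp only [LinearMap.coe_comp, Function.comp_apply]
  rw [G_d_R ΔA dc dcs a d dstar Rp Qp Q Qs Ω G hΔa hcurl hQd hRfix hΩd hΩdR hG hn hμ, hRfix n hn, hμ]

/-- **(2.34)₂ for `G(Ω)`: `QG(Ω)∂R = 0`.** [cite: Balaban1984PropagatorsII, p.228 ((2.31), (2.34) for G(Ω))] -/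
theorem eq234_Omega_right (hΔa : ΔA = dcs ∘ₗ dc + d ∘ₗ Rp ∘ₗ dstar + Qs ∘ₗ a ∘ₗ Q) (hcurl : dc ∘ₗ d = 0)
    (hQd : ∀ n ∈ B6SectA.gaugeSpace Qp, Q (d n) = 0)
    (hRrange : ∀ v : V, ∃ n ∈ B6SectA.gaugeSpace Qp, Rp v = dstar (d n))
    (hRfix : ∀ n ∈ B6SectA.gaugeSpace Qp, Rp (dstar (d n)) = dstar (d n))
    (hΩd : ∀ n ∈ B6SectA.gaugeSpace Qp, Ω (d n) = d n) (hΩdR : ∀ v : V, Ω (d (Rp v)) = d (Rp v))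
    (hG : ∀ y : A, G (Ω (ΔA (Ω y))) = Ω y) :
    Q ∘ₗ G ∘ₗ d ∘ₗ Rp = 0 := by
  ext μ
  obtain ⟨n, hn, hμ⟩ := hRrange μ
  simp only [LinearMap.coe_comp, Function.comp_apply, LinearMap.zero_apply]
  rw [G_d_R ΔA dc dcs a d dstar Rp Qp Q Qs Ω G hΔa hcurl hQd hRfix hΩd hΩdR hG hn hμ]
  exact hQd n hn

/-- **(2.34)₁ for `G(Ω)`: `R∂*G(Ω)Q* = 0`** (`G(Ω)` symmetric, as the inverse of the symmetric `Δ_a↾_Ω`; `Q*`, `∂*`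
adjoints, `R` symmetric). [cite: Balaban1984PropagatorsII, p.228 ((2.31), (2.34) for G(Ω))] -/
theorem eq234_Omega_left (hΔa : ΔA = dcs ∘ₗ dc + d ∘ₗ Rp ∘ₗ dstar + Qs ∘ₗ a ∘ₗ Q) (hcurl : dc ∘ₗ d = 0)
    (hQd : ∀ n ∈ B6SectA.gaugeSpace Qp, Q (d n) = 0)
    (hRrange : ∀ v : V, ∃ n ∈ B6SectA.gaugeSpace Qp, Rp v = dstar (d n))
    (hRfix : ∀ n ∈ B6SectA.gaugeSpace Qp, Rp (dstar (d n)) = dstar (d n))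
    (hΩd : ∀ n ∈ B6SectA.gaugeSpace Qp, Ω (d n) = d n) (hΩdR : ∀ v : V, Ω (d (Rp v)) = d (Rp v))
    (hG : ∀ y : A, G (Ω (ΔA (Ω y))) = Ω y)
    (hd : ∀ (v : V) (y : A), ⟪d v, y⟫_ℝ = ⟪v, dstar y⟫_ℝ) (hR : ∀ u v : V, ⟪Rp u, v⟫_ℝ = ⟪u, Rp v⟫_ℝ)
    (hQ : ∀ (w : W) (y : A), ⟪Qs w, y⟫_ℝ = ⟪w, Q y⟫_ℝ) (hGs : ∀ y z : A, ⟪G y, z⟫_ℝ = ⟪y, G z⟫_ℝ) :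
    Rp ∘ₗ dstar ∘ₗ G ∘ₗ Qs = 0 := by
  ext w
  simp only [LinearMap.coe_comp, Function.comp_apply, LinearMap.zero_apply]
  apply ext_inner_left ℝ
  intro μ
  obtain ⟨n, hn, hμ⟩ := hRrange μ
  rw [inner_zero_right, ← hR, ← hd, ← hGs,
    G_d_R ΔA dc dcs a d dstar Rp Qp Q Qs Ω G hΔa hcurl hQd hRfix hΩd hΩdR hG hn hμ, real_inner_comm, hQ, hQd n hn,
    inner_zero_right]

/-- **The same mechanism on the exterior source**: `R∂*G(Ω)Ω∂*∂X = 0` for every exterior field `X` — the boundary term of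
the `Ω`-Lagrange function exerts no force on the gauge-fixing multiplier (`∂*∂∂n = 0`). [cite: Balaban1984PropagatorsII, p.228 ((2.31), (2.34) for G(Ω))] -/
theorem R_dstar_G_C (hΔa : ΔA = dcs ∘ₗ dc + d ∘ₗ Rp ∘ₗ dstar + Qs ∘ₗ a ∘ₗ Q) (hcurl : dc ∘ₗ d = 0)
    (hQd : ∀ n ∈ B6SectA.gaugeSpace Qp, Q (d n) = 0)
    (hRrange : ∀ v : V, ∃ n ∈ B6SectA.gaugeSpace Qp, Rp v = dstar (d n))
    (hRfix : ∀ n ∈ B6SectA.gaugeSpace Qp, Rp (dstar (d n)) = dstar (d n))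
    (hΩd : ∀ n ∈ B6SectA.gaugeSpace Qp, Ω (d n) = d n) (hΩdR : ∀ v : V, Ω (d (Rp v)) = d (Rp v))
    (hG : ∀ y : A, G (Ω (ΔA (Ω y))) = Ω y)
    (hdc : ∀ (p : P) (y : A), ⟪dcs p, y⟫_ℝ = ⟪p, dc y⟫_ℝ)
    (hd : ∀ (v : V) (y : A), ⟪d v, y⟫_ℝ = ⟪v, dstar y⟫_ℝ) (hR : ∀ u v : V, ⟪Rp u, v⟫_ℝ = ⟪u, Rp v⟫_ℝ)
    (hΩ : ∀ y z : A, ⟪Ω y, z⟫_ℝ = ⟪y, Ω z⟫_ℝ) (hGs : ∀ y z : A, ⟪G y, z⟫_ℝ = ⟪y, G z⟫_ℝ) (X : A) :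
    Rp (dstar (G (Ω (dcs (dc X))))) = 0 := by
  apply ext_inner_left ℝ
  intro μ
  obtain ⟨n, hn, hμ⟩ := hRrange μ
  have hcurl' : dc (d n) = 0 := by simpa using LinearMap.congr_fun hcurl n
  rw [inner_zero_right, ← hR, ← hd, ← hGs,
    G_d_R ΔA dc dcs a d dstar Rp Qp Q Qs Ω G hΔa hcurl hQd hRfix hΩd hΩdR hG hn hμ, ← hΩ, hΩd n hn,
    real_inner_comm, hdc, hcurl', inner_zero_right]

end Identities

/-! ## §4 The critical point: `λ = 0` and the printed representation -/

section CriticalPoint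

variable (ΔA : A →ₗ[ℝ] A) (dc : A →ₗ[ℝ] P) (dcs : P →ₗ[ℝ] A) (a : W →ₗ[ℝ] W) (d : V →ₗ[ℝ] A)
  (dstar : A →ₗ[ℝ] V) (Rp : V →ₗ[ℝ] V) (Qp : V →ₗ[ℝ] W') (Q : A →ₗ[ℝ] W) (Qs : W →ₗ[ℝ] A) (Ω G : A →ₗ[ℝ] A)
  (E : W →ₗ[ℝ] W) (X : A) (B : W)

/-- **At a critical point of the `Ω`-Lagrange function the gauge-fixing multiplier vanishes: `λ = 0`.**  Pair the first
equation with a pure gauge `∂n`, `n ∈ N(Q′)` (an admissible variation: `Ω∂n = ∂n`): `⟨∂n, Δ_ax⟩ = ⟨∂∂n, ∂x⟩ +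
⟨∂*∂n, R∂*x⟩ + ⟨Q∂n, aQx⟩ = 0` (by `∂∂ = 0`, `R∂*x = 0`, `Q∂n = 0`), `⟨∂n, Ω∂*∂X⟩ = ⟨∂∂n, ∂X⟩ = 0`, `⟨∂n, Q*ω⟩ = 0`, so
`0 = ⟨∂n, ∂Rλ⟩ = ⟨∂*∂n, λ⟩`; choosing `n` with `∂*∂n = Rλ = λ` gives `‖λ‖² = 0`.  (This is why the printed representation
carries no `λ`-term.) [cite: Balaban1984PropagatorsII, p.228 (representation of A with G(Ω))] -/
theorem lam_eq_zero (hΔa : ΔA = dcs ∘ₗ dc + d ∘ₗ Rp ∘ₗ dstar + Qs ∘ₗ a ∘ₗ Q) (hcurl : dc ∘ₗ d = 0)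
    (hQd : ∀ n ∈ B6SectA.gaugeSpace Qp, Q (d n) = 0)
    (hRrange : ∀ v : V, ∃ n ∈ B6SectA.gaugeSpace Qp, Rp v = dstar (d n))
    (hΩd : ∀ n ∈ B6SectA.gaugeSpace Qp, Ω (d n) = d n)
    (hdc : ∀ (p : P) (y : A), ⟪dcs p, y⟫_ℝ = ⟪p, dc y⟫_ℝ)
    (hd : ∀ (v : V) (y : A), ⟪d v, y⟫_ℝ = ⟪v, dstar y⟫_ℝ)
    (hQ : ∀ (w : W) (y : A), ⟪Qs w, y⟫_ℝ = ⟪w, Q y⟫_ℝ) (hΩ : ∀ y z : A, ⟪Ω y, z⟫_ℝ = ⟪y, Ω z⟫_ℝ)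
    {x : A} {lam : V} {ω : W} (hRl : Rp lam = lam) (h : ELO ΔA dc dcs d dstar Rp Q Qs Ω X B x lam ω) :
    lam = 0 := by
  obtain ⟨hx, h1, h2, _⟩ := h
  obtain ⟨n, hn, hμ⟩ := hRrange lam
  rw [hRl] at hμ
  have hcurl' : dc (d n) = 0 := by simpa using LinearMap.congr_fun hcurl n
  -- pair the first equation with the pure gauge `∂n`
  have hpair : ⟪d n, Ω (Ω (ΔA (Ω x)) + Ω (dcs (dc X)) - d (Rp lam) - Qs ω)⟫_ℝ = 0 := by
    rw [h1, inner_zero_right]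
  rw [← hΩ, hΩd n hn, inner_sub_right, inner_sub_right, inner_add_right, ← hΩ, hΩd n hn, ← hΩ, hΩd n hn, hx]
    at hpair
  -- the four pairings
  have eΔ : ⟪d n, ΔA x⟫_ℝ = 0 := by
    rw [B6Eq218Lagrangian.inner_deltaA ΔA a dc dcs d dstar Rp Q Qs hΔa hdc hd hQ (d n) x, hcurl', h2,
      hQd n hn, inner_zero_left, inner_zero_right, inner_zero_left, add_zero, add_zero]
  have eX : ⟪d n, dcs (dc X)⟫_ℝ = 0 := by rw [real_inner_comm, hdc, hcurl', inner_zero_right]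
  have eR : ⟪d n, d (Rp lam)⟫_ℝ = ⟪lam, lam⟫_ℝ := by rw [hRl, real_inner_comm, hd, ← hμ]
  have eQ : ⟪d n, Qs ω⟫_ℝ = 0 := by rw [real_inner_comm, hQ, hQd n hn, inner_zero_right]
  rw [eΔ, eX, eR, eQ, zero_add, zero_sub, sub_zero, neg_eq_zero] at hpair
  exact inner_self_eq_zero.mp hpair

/-- **p. 228: the critical point, AS PRINTED** — *"Solving critical point equations for h(A, λ, ω) and denoting
G(Ω) = (Δ_a↾_Ω)⁻¹ = (ΩΔ_aΩ)⁻¹, we get A = G(Ω)Q*(QG(Ω)Q*)⁻¹B + G(Ω)Q*(QG(Ω)Q*)⁻¹QG(Ω)∂*∂Ω^cB − G(Ω)∂*∂Ω^cB"*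
(`∂*∂Ω^cB = dcs (dc X)`; `G = G(Ω)` a left inverse of `ΩΔ_aΩ` on the `Ω`-fields with `GΩ = G`; `E` a left inverse of
`QG(Ω)Q*`); moreover `λ = 0` and `ω = (QG(Ω)Q*)⁻¹(B + QG(Ω)∂*∂Ω^cB)`. [cite: Balaban1984PropagatorsII, p.228 (representation of A with G(Ω))] -/
theorem critical_repr (hΔa : ΔA = dcs ∘ₗ dc + d ∘ₗ Rp ∘ₗ dstar + Qs ∘ₗ a ∘ₗ Q) (hcurl : dc ∘ₗ d = 0)
    (hQd : ∀ n ∈ B6SectA.gaugeSpace Qp, Q (d n) = 0)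
    (hRrange : ∀ v : V, ∃ n ∈ B6SectA.gaugeSpace Qp, Rp v = dstar (d n))
    (hΩd : ∀ n ∈ B6SectA.gaugeSpace Qp, Ω (d n) = d n)
    (hdc : ∀ (p : P) (y : A), ⟪dcs p, y⟫_ℝ = ⟪p, dc y⟫_ℝ)
    (hd : ∀ (v : V) (y : A), ⟪d v, y⟫_ℝ = ⟪v, dstar y⟫_ℝ)
    (hQ : ∀ (w : W) (y : A), ⟪Qs w, y⟫_ℝ = ⟪w, Q y⟫_ℝ) (hΩ : ∀ y z : A, ⟪Ω y, z⟫_ℝ = ⟪y, Ω z⟫_ℝ)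
    (hGΩ : G ∘ₗ Ω = G) (hG : ∀ y : A, G (Ω (ΔA (Ω y))) = Ω y) (hE : E ∘ₗ (Q ∘ₗ G ∘ₗ Qs) = LinearMap.id)
    {x : A} {lam : V} {ω : W} (hRl : Rp lam = lam) (h : ELO ΔA dc dcs d dstar Rp Q Qs Ω X B x lam ω) :
    lam = 0 ∧ ω = E (B + Q (G (dcs (dc X)))) ∧
      x = B6SectA.hOp G Qs E B + B6SectA.hOp G Qs E (Q (G (dcs (dc X)))) - G (dcs (dc X)) := by
  have hlam := lam_eq_zero ΔA dc dcs a d dstar Rp Qp Q Qs Ω X B hΔa hcurl hQd hRrange hΩd hdc hd hQ hΩ hRl h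
  obtain ⟨hx, h1, _, h3⟩ := h
  have hGΩ' : ∀ y, G (Ω y) = G y := fun y => by simpa using LinearMap.congr_fun hGΩ y
  have hE' : ∀ w, E (Q (G (Qs w))) = w := fun w => by simpa using LinearMap.congr_fun hE w
  -- apply G to the first equation: x = G Q*ω − G ∂*∂X
  have hxrep : x = G (Qs ω) - G (dcs (dc X)) := by
    have := congrArg G h1
    rw [map_zero, hGΩ', map_sub, map_sub, map_add, hG, hGΩ', hx, hlam, map_zero, map_zero, map_zero,
      sub_zero] at this
    -- this : x + G (dcs (dc X)) - G (Qs ω) = 0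
    rw [sub_eq_zero] at this
    rw [← this, add_sub_cancel_right]
  -- the constraint determines ω
  have hω : ω = E (B + Q (G (dcs (dc X)))) := by
    have hQx := h3
    rw [hxrep, map_sub] at hQx
    -- hQx : Q (G (Qs ω)) - Q (G (dcs (dc X))) = B
    have : Q (G (Qs ω)) = B + Q (G (dcs (dc X))) := by rw [← hQx, sub_add_cancel]
    rw [← this, hE']
  refine ⟨hlam, hω, ?_⟩
  rw [hxrep, hω]
  simp only [B6SectA.hOp, LinearMap.coe_comp, Function.comp_apply, map_add]

/-- ***"If B = 0 outside Ω₁, then the above representation simplifies and we get (2.35) with G(Ω) instead of G"***: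
with no exterior field (`X = 0`) every critical point has `x = H(Ω)B = G(Ω)Q*(QG(Ω)Q*)⁻¹B` (`B6SectA.hOp`).
[cite: Balaban1984PropagatorsII, p.228 ((2.35) with G(Ω))] -/
theorem critical_repr_of_exterior_zero (hΔa : ΔA = dcs ∘ₗ dc + d ∘ₗ Rp ∘ₗ dstar + Qs ∘ₗ a ∘ₗ Q)
    (hcurl : dc ∘ₗ d = 0) (hQd : ∀ n ∈ B6SectA.gaugeSpace Qp, Q (d n) = 0)
    (hRrange : ∀ v : V, ∃ n ∈ B6SectA.gaugeSpace Qp, Rp v = dstar (d n))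
    (hΩd : ∀ n ∈ B6SectA.gaugeSpace Qp, Ω (d n) = d n)
    (hdc : ∀ (p : P) (y : A), ⟪dcs p, y⟫_ℝ = ⟪p, dc y⟫_ℝ)
    (hd : ∀ (v : V) (y : A), ⟪d v, y⟫_ℝ = ⟪v, dstar y⟫_ℝ)
    (hQ : ∀ (w : W) (y : A), ⟪Qs w, y⟫_ℝ = ⟪w, Q y⟫_ℝ) (hΩ : ∀ y z : A, ⟪Ω y, z⟫_ℝ = ⟪y, Ω z⟫_ℝ)
    (hGΩ : G ∘ₗ Ω = G) (hG : ∀ y : A, G (Ω (ΔA (Ω y))) = Ω y) (hE : E ∘ₗ (Q ∘ₗ G ∘ₗ Qs) = LinearMap.id)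
    {x : A} {lam : V} {ω : W} (hRl : Rp lam = lam) (h : ELO ΔA dc dcs d dstar Rp Q Qs Ω 0 B x lam ω) :
    lam = 0 ∧ ω = E B ∧ x = B6SectA.hOp G Qs E B := by
  obtain ⟨hl, hω, hx⟩ :=
    critical_repr ΔA dc dcs a d dstar Rp Qp Q Qs Ω G E 0 B hΔa hcurl hQd hRrange hΩd hdc hd hQ hΩ hGΩ hG hE hRl h
  simp only [map_zero, add_zero, sub_zero] at hω hx
  exact ⟨hl, hω, hx⟩

/-- **Conversely, the printed triple IS a critical point**: with `G(Ω)` also a right inverse of `ΩΔ_aΩ` on the `Ω`-fields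
(`ΩG = G`, `hG'`), `E` a right inverse of `QG(Ω)Q*`, and the `G(Ω)`-identities of §3 (`R∂*G(Ω)Q* = 0`,
`R∂*G(Ω)Ω∂*∂X = 0`, here from the structure through `eq234_Omega_left` / `R_dstar_G_C`), the configuration
`x = G(Ω)Q*E B + G(Ω)Q*E QG(Ω)∂*∂X − G(Ω)∂*∂X` with `λ = 0`, `ω = E(B + QG(Ω)∂*∂X)` solves `ELO`.
[cite: Balaban1984PropagatorsII, p.228 (representation of A with G(Ω))] -/
theorem ELO_repr (hΔa : ΔA = dcs ∘ₗ dc + d ∘ₗ Rp ∘ₗ dstar + Qs ∘ₗ a ∘ₗ Q) (hcurl : dc ∘ₗ d = 0)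
    (hQd : ∀ n ∈ B6SectA.gaugeSpace Qp, Q (d n) = 0)
    (hRrange : ∀ v : V, ∃ n ∈ B6SectA.gaugeSpace Qp, Rp v = dstar (d n))
    (hRfix : ∀ n ∈ B6SectA.gaugeSpace Qp, Rp (dstar (d n)) = dstar (d n))
    (hΩd : ∀ n ∈ B6SectA.gaugeSpace Qp, Ω (d n) = d n) (hΩdR : ∀ v : V, Ω (d (Rp v)) = d (Rp v))
    (hdc : ∀ (p : P) (y : A), ⟪dcs p, y⟫_ℝ = ⟪p, dc y⟫_ℝ)
    (hd : ∀ (v : V) (y : A), ⟪d v, y⟫_ℝ = ⟪v, dstar y⟫_ℝ) (hR : ∀ u v : V, ⟪Rp u, v⟫_ℝ = ⟪u, Rp v⟫_ℝ)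
    (hQ : ∀ (w : W) (y : A), ⟪Qs w, y⟫_ℝ = ⟪w, Q y⟫_ℝ) (hΩ : ∀ y z : A, ⟪Ω y, z⟫_ℝ = ⟪y, Ω z⟫_ℝ)
    (hGs : ∀ y z : A, ⟪G y, z⟫_ℝ = ⟪y, G z⟫_ℝ) (hGΩ : G ∘ₗ Ω = G) (hΩG : Ω ∘ₗ G = G) (hΩΩ : Ω ∘ₗ Ω = Ω)
    (hG : ∀ y : A, G (Ω (ΔA (Ω y))) = Ω y) (hG' : ∀ y : A, Ω (ΔA (G y)) = Ω y)
    (hE' : (Q ∘ₗ G ∘ₗ Qs) ∘ₗ E = LinearMap.id) :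
    ELO ΔA dc dcs d dstar Rp Q Qs Ω X B
      (B6SectA.hOp G Qs E B + B6SectA.hOp G Qs E (Q (G (dcs (dc X)))) - G (dcs (dc X))) 0
      (E (B + Q (G (dcs (dc X))))) := by
  have hGΩ' : ∀ y, G (Ω y) = G y := fun y => by simpa using LinearMap.congr_fun hGΩ y
  have hΩG' : ∀ y, Ω (G y) = G y := fun y => by simpa using LinearMap.congr_fun hΩG y
  have hΩΩ' : ∀ y, Ω (Ω y) = Ω y := fun y => by simpa using LinearMap.congr_fun hΩΩ y
  have hE'' : ∀ w, Q (G (Qs (E w))) = w := fun w => by simpa using LinearMap.congr_fun hE' w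
  have h234 : ∀ w, Rp (dstar (G (Qs w))) = 0 := fun w => by
    simpa using LinearMap.congr_fun (eq234_Omega_left ΔA dc dcs a d dstar Rp Qp Q Qs Ω G hΔa hcurl hQd hRrange
      hRfix hΩd hΩdR hG hd hR hQ hGs) w
  have hRC : Rp (dstar (G (dcs (dc X)))) = 0 := by
    have := R_dstar_G_C ΔA dc dcs a d dstar Rp Qp Q Qs Ω G hΔa hcurl hQd hRrange hRfix hΩd hΩdR hG hdc hd hR hΩ
      hGs X
    rwa [hGΩ'] at this
  -- the candidate is `x = G y₀` with `y₀ = Q*ω − ∂*∂X`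
  set ω := E (B + Q (G (dcs (dc X)))) with hωdef
  have hxG : B6SectA.hOp G Qs E B + B6SectA.hOp G Qs E (Q (G (dcs (dc X)))) - G (dcs (dc X)) =
      G (Qs ω - dcs (dc X)) := by
    simp only [B6SectA.hOp, LinearMap.coe_comp, Function.comp_apply, hωdef, map_add, map_sub]
  rw [hxG]
  refine ⟨hΩG' _, ?_, ?_, ?_⟩
  · -- first equation: Ω[ΩΔ_aΩ(G y₀) + Ω∂*∂X − ∂R0 − Q*ω] = Ω[Ω y₀ + Ω∂*∂X − Q*ω] = Ω y₀ + Ω∂*∂X − ΩQ*ω = 0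
    have e1 : Ω (ΔA (Ω (G (Qs ω - dcs (dc X))))) = Ω (Qs ω - dcs (dc X)) := by rw [hΩG', hG']
    rw [e1, map_zero, map_zero, sub_zero]
    simp only [map_sub, map_add, hΩΩ']
    abel
  · rw [map_sub, map_sub, map_sub, h234, hRC, sub_zero]
  · rw [map_sub, map_sub, hωdef, hE'', add_sub_cancel_right]

/-- **"exactly one" for the `Ω`-problem**: under the hypotheses of `critical_repr` and `ELO_repr`, the critical-point system of
the `Ω`-Lagrange function (with `Rλ = λ`) has exactly one solution, the printed one. [cite: Balaban1984PropagatorsII, p.228 (representation of A with G(Ω))] -/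
theorem existsUnique_ELO (hΔa : ΔA = dcs ∘ₗ dc + d ∘ₗ Rp ∘ₗ dstar + Qs ∘ₗ a ∘ₗ Q) (hcurl : dc ∘ₗ d = 0)
    (hQd : ∀ n ∈ B6SectA.gaugeSpace Qp, Q (d n) = 0)
    (hRrange : ∀ v : V, ∃ n ∈ B6SectA.gaugeSpace Qp, Rp v = dstar (d n))
    (hRfix : ∀ n ∈ B6SectA.gaugeSpace Qp, Rp (dstar (d n)) = dstar (d n))
    (hΩd : ∀ n ∈ B6SectA.gaugeSpace Qp, Ω (d n) = d n) (hΩdR : ∀ v : V, Ω (d (Rp v)) = d (Rp v))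
    (hdc : ∀ (p : P) (y : A), ⟪dcs p, y⟫_ℝ = ⟪p, dc y⟫_ℝ)
    (hd : ∀ (v : V) (y : A), ⟪d v, y⟫_ℝ = ⟪v, dstar y⟫_ℝ) (hR : ∀ u v : V, ⟪Rp u, v⟫_ℝ = ⟪u, Rp v⟫_ℝ)
    (hQ : ∀ (w : W) (y : A), ⟪Qs w, y⟫_ℝ = ⟪w, Q y⟫_ℝ) (hΩ : ∀ y z : A, ⟪Ω y, z⟫_ℝ = ⟪y, Ω z⟫_ℝ)
    (hGs : ∀ y z : A, ⟪G y, z⟫_ℝ = ⟪y, G z⟫_ℝ) (hGΩ : G ∘ₗ Ω = G) (hΩG : Ω ∘ₗ G = G) (hΩΩ : Ω ∘ₗ Ω = Ω)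
    (hG : ∀ y : A, G (Ω (ΔA (Ω y))) = Ω y) (hG' : ∀ y : A, Ω (ΔA (G y)) = Ω y)
    (hE : E ∘ₗ (Q ∘ₗ G ∘ₗ Qs) = LinearMap.id) (hE' : (Q ∘ₗ G ∘ₗ Qs) ∘ₗ E = LinearMap.id) :
    ∃! t : A × V × W, Rp t.2.1 = t.2.1 ∧ ELO ΔA dc dcs d dstar Rp Q Qs Ω X B t.1 t.2.1 t.2.2 := by
  refine ⟨(B6SectA.hOp G Qs E B + B6SectA.hOp G Qs E (Q (G (dcs (dc X)))) - G (dcs (dc X)), 0,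
    E (B + Q (G (dcs (dc X))))), ⟨map_zero Rp, ?_⟩, ?_⟩
  · exact ELO_repr ΔA dc dcs a d dstar Rp Qp Q Qs Ω G E X B hΔa hcurl hQd hRrange hRfix hΩd hΩdR hdc hd hR hQ hΩ
      hGs hGΩ hΩG hΩΩ hG hG' hE'
  · rintro ⟨x, lam, ω⟩ ⟨hRl, h⟩
    obtain ⟨hl, hω, hx⟩ :=
      critical_repr ΔA dc dcs a d dstar Rp Qp Q Qs Ω G E X B hΔa hcurl hQd hRrange hΩd hdc hd hQ hΩ hGΩ hG hE hRl h
    simp only [Prod.mk.injEq]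
    exact ⟨hx, hl, hω⟩

end CriticalPoint

end Literature.MathematicalPhysics.QuantumFieldTheory.Balaban1983to89.B6GOmegaCritical

end
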